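import Mathlib
import Summits.ValiantsHypothesis.ValiantsHypothesis.Theorems.BarrierLeverPartitionMinorsHitByVPSimplexJoinTwoDeep

/-!
# Route BarrierLever — item `PartitionMinorsHitByVP` (19717): the BIG PIECE of a simplex-product design and the PIECE RESTRICTION
Helper file (`--supports stmt-ValiantsHypothesis-19717`; cell valiant-natproofs, 𝒟-side door (c), line `hidden_states`, uniform-menu
lane; prover seat val-np-p3 gen 12). One bookkeeping `def` (`pieceDesign`). Closes NO item. Two structural steps of the case map of memo
val-np-p3 g12 §2(f) toward a kernel `not_uniformMenuSimplex`:
* `card_piece_le_of_subsingleton_slots` / **`exists_big_piece`** — a piece all of whose slots but at most one are dead (`S p f = ∅`) has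
  at most `N + 1` columns; hence if `r > m·(N+1)` some piece has two distinct live slots (pigeonhole over pieces);
* **`pieceDesign`, `pieceDesign_injective`, `pieceDesign_live`, `piece_matrix_eq`** — the columns of one piece, re-enumerated by a
  bijection `c`, form an exact-support design with ONE piece whose `u`-side matrix (table `fun _ => t`) is literally the matrix of the
  uniformity clause of `Stmt.uniformMenuSimplex`; so every design-level singularity lemma of the toolkit (`…TwoDeep`, `…TwoDeepRank`,
  `…TwoSlotsLevels`, `…ThreeSlots` … `…SixSlots`, `…AffineDeficit`) refutes the uniformity of a single piece (`not_uniform_of_pieceDesign`).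
Nothing on crux 14610 or VP ≠ VNP; item 19717 stays OPEN.
-/

set_option linter.dupNamespace false

namespace Summit.ValiantsHypothesis.ValiantsHypothesis.Theorems.BarrierLever.SimplexJoin

open Finset Matrix

variable {h m D N r : ℕ}

/-- If at most one slot `f₀` of piece `p` is live, the columns of `p` are determined by their option at `f₀`: at most `N + 1` of them. -/
theorem card_piece_le_of_subsingleton_slots (S : Fin m → Fin D → Finset (Fin N))
    (e : Fin r → Fin m × (Fin D → Option (Fin N))) (he : Function.Injective e)
    (hlive : ∀ c : Fin m × (Fin D → Option (Fin N)),
      c ∈ Set.range e ↔ ∀ (f : Fin D) (j : Fin N), c.2 f = some j → j ∈ S c.1 f)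
    (p : Fin m) (f₀ : Fin D) (hdead : ∀ f, f ≠ f₀ → S p f = ∅) :
    (Finset.univ.filter fun k => (e k).1 = p).card ≤ N + 1 := by
  classical
  have key : ∀ k, (e k).1 = p → ∀ f, f ≠ f₀ → (e k).2 f = none := by
    intro k hk f hf
    rcases hkf : (e k).2 f with _ | j
    · rfl
    · have := ((hlive (e k)).mp ⟨k, rfl⟩) f j hkf
      rw [hk, hdead f hf] at this
      exact absurd this (Finset.notMem_empty _)
  have hinj : Set.InjOn (fun k => (e k).2 f₀) ↑(Finset.univ.filter fun k => (e k).1 = p) := by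
    intro k hk k' hk' hkk'
    simp only [Finset.coe_filter, Finset.mem_univ, true_and, Set.mem_setOf_eq] at hk hk'
    apply he
    refine Prod.ext (hk.trans hk'.symm) (funext fun f => ?_)
    by_cases hf : f = f₀
    · subst hf; exact hkk'
    · rw [key k hk f hf, key k' hk' f hf]
  calc (Finset.univ.filter fun k => (e k).1 = p).card
      = ((Finset.univ.filter fun k => (e k).1 = p).image fun k => (e k).2 f₀).card := (Finset.card_image_of_injOn hinj).symm
    _ ≤ (Finset.univ : Finset (Option (Fin N))).card := Finset.card_le_card (Finset.subset_univ _)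
    _ = N + 1 := by simp

/-- **The big piece.** If `r > m·(N+1)`, some piece has at least `⌈r/m⌉` columns and two distinct LIVE slots. -/
theorem exists_big_piece (S : Fin m → Fin D → Finset (Fin N))
    (e : Fin r → Fin m × (Fin D → Option (Fin N))) (he : Function.Injective e)
    (hlive : ∀ c : Fin m × (Fin D → Option (Fin N)),
      c ∈ Set.range e ↔ ∀ (f : Fin D) (j : Fin N), c.2 f = some j → j ∈ S c.1 f)
    (hr : m * (N + 1) < r) :
    ∃ p : Fin m, r ≤ m * (Finset.univ.filter fun k => (e k).1 = p).card ∧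
      ∃ f₁ f₂ : Fin D, f₁ ≠ f₂ ∧ (S p f₁).Nonempty ∧ (S p f₂).Nonempty := by
  classical
  have hm : 0 < m := by
    rcases Nat.eq_zero_or_pos m with h0 | h0
    · subst h0
      have : r = 0 := by
        rcases Nat.eq_zero_or_pos r with hr0 | hr0
        · exact hr0
        · exact ((e ⟨0, hr0⟩).1).elim0
      omega
    · exact h0
  -- the piece with the most columns
  obtain ⟨p, -, hp⟩ := Finset.exists_max_image (Finset.univ : Finset (Fin m))
    (fun p => (Finset.univ.filter fun k => (e k).1 = p).card) ⟨⟨0, hm⟩, Finset.mem_univ _⟩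
  have hsum : r = ∑ q : Fin m, (Finset.univ.filter fun k => (e k).1 = q).card := by
    have := Finset.card_eq_sum_card_fiberwise (f := fun k => (e k).1) (s := (Finset.univ : Finset (Fin r)))
      (t := (Finset.univ : Finset (Fin m))) (fun _ _ => Finset.mem_univ _)
    simpa using this
  have hbig : r ≤ m * (Finset.univ.filter fun k => (e k).1 = p).card := by
    calc r = ∑ q : Fin m, (Finset.univ.filter fun k => (e k).1 = q).card := hsum
      _ ≤ ∑ _q : Fin m, (Finset.univ.filter fun k => (e k).1 = p).card :=
          Finset.sum_le_sum fun q _ => hp q (Finset.mem_univ _)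
      _ = m * (Finset.univ.filter fun k => (e k).1 = p).card := by simp
  refine ⟨p, hbig, ?_⟩
  -- two live slots: otherwise the piece has ≤ N + 1 columns, contradicting `r > m (N+1)`
  by_contra hno
  push Not at hno
  have hcard : (Finset.univ.filter fun k => (e k).1 = p).card ≤ N + 1 := by
    by_cases hex : ∃ f₀, (S p f₀).Nonempty
    · obtain ⟨f₀, hf₀⟩ := hex
      refine card_piece_le_of_subsingleton_slots S e he hlive p f₀ fun f hf => ?_
      by_contra hne
      exact Finset.nonempty_iff_ne_empty.mp hf₀ (hno f f₀ hf (Finset.nonempty_iff_ne_empty.mpr hne))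
    · push Not at hex
      rcases Nat.eq_zero_or_pos D with hD | hD
      · -- no slots at all: the piece has at most one column (all patterns equal)
        have : (Finset.univ.filter fun k => (e k).1 = p).card ≤ 1 := by
          refine Finset.card_le_one.mpr fun k hk k' hk' => he (Prod.ext ?_ (funext fun f => ?_))
          · exact (Finset.mem_filter.mp hk).2.trans (Finset.mem_filter.mp hk').2.symm
          · subst hD; exact f.elim0
        omega
      · exact card_piece_le_of_subsingleton_slots S e he hlive p ⟨0, hD⟩ fun f _ => hex f
  have := Nat.mul_le_mul_left m hcard
  omega

/-! ## The piece restriction -/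

/-- The columns of piece `p`, enumerated by `c`, as a one-piece design. -/
def pieceDesign (e : Fin r → Fin m × (Fin D → Option (Fin N))) {n : ℕ} (c : Fin n → Fin r) :
    Fin n → Fin 1 × (Fin D → Option (Fin N)) := fun x => (0, (e (c x)).2)

/-- The restricted design is injective. -/
theorem pieceDesign_injective (e : Fin r → Fin m × (Fin D → Option (Fin N))) (he : Function.Injective e)
    (p : Fin m) {n : ℕ} (c : Fin n → Fin r) (hc : Function.Injective c) (hcp : ∀ x, (e (c x)).1 = p) :
    Function.Injective (pieceDesign e c) := by
  intro x x' hxx'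
  have h2 := congrArg Prod.snd hxx'
  simp only [pieceDesign] at h2
  exact hc (he (Prod.ext ((hcp x).trans (hcp x').symm) h2))

/-- The restricted design has exact ranges for the live sets `S p`. -/
theorem pieceDesign_live (S : Fin m → Fin D → Finset (Fin N)) (e : Fin r → Fin m × (Fin D → Option (Fin N)))
    (hlive : ∀ c : Fin m × (Fin D → Option (Fin N)),
      c ∈ Set.range e ↔ ∀ (f : Fin D) (j : Fin N), c.2 f = some j → j ∈ S c.1 f)
    (p : Fin m) {n : ℕ} (c : Fin n → Fin r) (hcp : ∀ x, (e (c x)).1 = p) (hsurj : ∀ k, (e k).1 = p → ∃ x, c x = k)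
    (c' : Fin 1 × (Fin D → Option (Fin N))) :
    c' ∈ Set.range (pieceDesign e c) ↔ ∀ (f : Fin D) (j : Fin N), c'.2 f = some j → j ∈ (fun (_ : Fin 1) f => S p f) c'.1 f := by
  constructor
  · rintro ⟨x, rfl⟩ f j hj
    have := ((hlive (e (c x))).mp ⟨c x, rfl⟩) f j hj
    rwa [hcp x] at this
  · intro hc'
    have hmem : (p, c'.2) ∈ Set.range e := (hlive (p, c'.2)).mpr hc'
    obtain ⟨k, hk⟩ := hmem
    obtain ⟨x, hx⟩ := hsurj k (by rw [hk])
    refine ⟨x, Prod.ext (Subsingleton.elim _ _) ?_⟩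
    simp only [pieceDesign]
    rw [hx, hk]

/-- The piece matrix of the uniformity clause is the `u`-side matrix of the restricted design with the constant table. -/
theorem piece_matrix_eq (e : Fin r → Fin m × (Fin D → Option (Fin N))) {n : ℕ} (c : Fin n → Fin r)
    (v : Fin n → Finset (Fin h)) (t : Option (Fin D × Fin N) → Fin h → ℂ) :
    (Matrix.of fun x x' : Fin n => ∏ a ∈ v x,
      (t none a + ∑ f : Fin D, ((e (c x')).2 f).elim 0 fun j => t (some (f, j)) a)) =
    (Matrix.of fun x x' : Fin n => ∏ a ∈ v x,
      ((fun _ : Fin 1 => t) (pieceDesign e c x').1 none a +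
        ∑ f : Fin D, ((pieceDesign e c x').2 f).elim 0 fun j => (fun _ : Fin 1 => t) (pieceDesign e c x').1 (some (f, j)) a)) := by
  rfl

/-- **Refuting uniformity of a piece through the restricted design.** If some row family `v` makes the restricted design's matrix
singular for EVERY table `T : Fin 1 → …`, then the uniformity clause of `Stmt.uniformMenuSimplex` fails for that piece at `v`. -/
theorem not_uniform_of_pieceDesign (e : Fin r → Fin m × (Fin D → Option (Fin N))) {n : ℕ} (c : Fin n → Fin r)
    (v : Fin n → Finset (Fin h))
    (hsing : ∀ T : Fin 1 → Option (Fin D × Fin N) → Fin h → ℂ,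
      (Matrix.of fun x x' : Fin n => ∏ a ∈ v x,
        (T (pieceDesign e c x').1 none a +
          ∑ f : Fin D, ((pieceDesign e c x').2 f).elim 0 fun j => T (pieceDesign e c x').1 (some (f, j)) a)).det = 0) :
    ¬ ∃ t : Option (Fin D × Fin N) → Fin h → ℂ,
      (Matrix.of fun x x' : Fin n => ∏ a ∈ v x,
        (t none a + ∑ f : Fin D, ((e (c x')).2 f).elim 0 fun j => t (some (f, j)) a)).det ≠ 0 := by
  rintro ⟨t, ht⟩
  exact ht (by rw [piece_matrix_eq]; exact hsing fun _ => t)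

end Summit.ValiantsHypothesis.ValiantsHypothesis.Theorems.BarrierLever.SimplexJoin
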